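import Literature.Topology.FourManifolds.InvolutiveCorkDecomposition
import Literature.Topology.FourManifolds.CorkDecompositionInvolutive
import Literature.Topology.FourManifolds.CorkDecompositionSplit
import Literature.Topology.FourManifolds.CorkDecompositionProofs
import HarnessLib

/-!
# The cork decomposition theorem WITH INVOLUTION: reduction to Matveyev's part 1 + Fact

Topic `Literature/Topology/FourManifolds` (fact seat
`provefact-Literature.Topology.FourManifolds.involutiveCorkDecomposition`). Everything in this file
is **proved**; no definition of a proposition is introduced (net debt `0`).

The named fact `Literature.Topology.FourManifolds.involutiveCorkDecomposition`
(`InvolutiveCorkDecomposition.lean`) is the cork theorem with involution: h-cobordant simply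
connected closed smooth 4-manifolds are `X₁ = C ∪_φ W`, `X₂ = C ∪_{φ ∘ τ} W` with `C` compact
contractible and `τ` an INVOLUTION of `∂C` — R. Kirby, *Akbulut's corks and h-cobordisms of
smooth, simply connected 4-manifolds*, Turkish J. Math. 20 (1996), arXiv:math/9712231, Theorem
with Addendum (D) ("`A₀` is diffeomorphic to `A₁` by a diffeomorphism which, restricted to
`∂A₀ = ∂A₁`, is an involution [mat95]"); Akbulut–Yasui 2008, Thm. 1.1. Kirby credits the
involution to Matveyev [mat95], and indeed it is a by-product of Matveyev's proof of part 2 of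
his Theorem (J. Differential Geom. 44 (1996), arXiv:dg-ga/9505001, p. 3 and fig. 2), which the
tree has formalised (`CorkDecompositionAssembly.lean`, `CorkDecompositionSplittingProof.lean`,
`SeamAdaptedWitnesses.lean`): with `ψ = φ₂⁻¹ ∘ φ₁ : ∂W₁ ≅ ∂W₂`,

* `X₁ ≅ X₁ # S⁴ = (W₁ ∪_{φ₁} M) # (W₂ ∪_{ψ⁻¹} W₁) = (W₁ ♮ W₂) ∪ (M ♮ W₁)`,
* `X₂ ≅ X₂ # S⁴ = (W₂ ∪_{φ₂} M) # (W₁ ∪_{id} W₁) = (W₂ ♮ W₁) ∪ (M ♮ W₁)`,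

the new cork being `W' = W₁ ♮ W₂ = W₂ ♮ W₁` (ONE manifold, Juhász's relation being symmetric)
and the new exterior `M' = M ♮ W₁`. In the tree's constructive splitting
(`SeamSide.isBoundaryGluing_glued`) both gluings are along the identity of `Σ # Σ`, for two
presentations of `∂W'` and of `∂M'`; re-indexing the second presentation to the first
(`BoundaryData.restrictDiffeomorph` of the identity) the two boundary identifications
`∂W' ≅ ∂M'` differ by the self-map `τ` of `∂W' = (∂W₁ ∖ pt) ∪ (∂W₂ ∖ pt)` exchanging the two
halves, `τ (inl z) = inr (ψ z)`, `τ (inr w) = inl (ψ⁻¹ w)` — an involution. This is exactly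
Kirby's "obvious involution" of `(A₀ ∪_{B³} A₁)` (loc. cit. §5), realised on Matveyev's pieces.

## Main statements (all proved)

* `Literature.Topology.FourManifolds.involutiveCorkDecomposition_of_partOne_and_fact`:
  `Matveyev1996_partOne_and_fact.{0} → involutiveCorkDecomposition` — the involutive cork theorem
  reduced to the SAME single named fact as the tree's non-involutive forms
  (`Matveyev1996_partOne_and_fact.matveyev1996_decomposition`, `CorkDecompositionMatveyevForm.lean`).
* `Literature.Topology.FourManifolds.involutiveCorkDecomposition_holds_of`: from the two leaves of
  the split record `CorkDecompositionSplit.lean` (Milnor's Basis Theorem 7.6 on a slab, and (H4)).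
* `Literature.Topology.FourManifolds.involutiveCorkDecomposition_iff_matveyev1996_involutiveDecomposition`:
  the two vendored renderings of the involutive cork theorem (this fact and
  `Literature.Topology.FourManifolds.matveyev1996_involutiveDecomposition`,
  `CorkDecompositionInvolutive.lean`, which differ by the order of binders only) are equivalent;
  whence `matveyev1996_involutiveDecomposition_of_partOne_and_fact`.
* `Literature.Topology.FourManifolds.matveyev1996_decomposition_of_involutiveCorkDecomposition`,
  `Literature.Topology.FourManifolds.corkDecomposition_of_involutiveCorkDecomposition`: the
  involutive form refines the tree's non-involutive forms (faithfulness certificates).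

## References

* R. Kirby, *Akbulut's corks and h-cobordisms of smooth, simply connected 4-manifolds*, Turkish
  J. Math. 20 (1996) 85–93; arXiv:math/9712231: Theorem, Addendum (D) (p. 1), §5 (proof of (D)).
  [KirbyCorks1996]
* R. Matveyev, *A decomposition of smooth simply-connected h-cobordant 4-manifolds*,
  J. Differential Geom. 44 (1996) 571–582; arXiv:dg-ga/9505001: Theorem, Fact 1 and the proof of
  part 2 with fig. 2 (p. 3). [Matveyev1996]
* S. Akbulut, K. Yasui, *Corks, plugs and exotic structures*, J. Gökova Geom. Topol. 2 (2008),
  arXiv:0806.3010, Thm. 1.1. [AkbulutYasui2008]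
* C. L. Curtis, M. H. Freedman, W.-C. Hsiang, R. Stong, Invent. Math. 123 (1996) 343–348.
  [CurtisFreedmanHsiangStong1996]
* A. Juhász, *Differential and Low-Dimensional Topology* (2023), Def. 1.47. [Juhasz2023]
-/

open scoped Manifold ContDiff Topology
open Set Function

noncomputable section

namespace Literature.Topology.FourManifolds

/-! ### §1 The two renderings of the involutive cork theorem agree -/

/-- **The two vendored renderings of the cork theorem with involution are equivalent**:
`involutiveCorkDecomposition` (`InvolutiveCorkDecomposition.lean`, binders
`C …, bC, W …, bW, φ, τ`) and `matveyev1996_involutiveDecomposition`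
(`CorkDecompositionInvolutive.lean`, binders `C …, W …, bC, bW, τ, φ`) differ by the order of
their existential binders only. [cite: KirbyCorks1996, Theorem and Addendum (D), p. 1] -/
theorem involutiveCorkDecomposition_iff_matveyev1996_involutiveDecomposition :
    involutiveCorkDecomposition ↔ matveyev1996_involutiveDecomposition := by
  constructor
  · intro h X₁ X₂ _ _ _ _ _ _ _ _ _ _ _ _ _ _ hcob
    obtain ⟨C, _, _, _, _, _, _, _, bC, W, _, _, _, _, _, _, bW, φ, τ, hτ, h₁, h₂⟩ := h X₁ X₂ hcob
    exact ⟨C, ‹_›, ‹_›, ‹_›, ‹_›, ‹_›, ‹_›, ‹_›, W, ‹_›, ‹_›, ‹_›, ‹_›, ‹_›, ‹_›, bC, bW, τ, φ, hτ,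
      h₁, h₂⟩
  · intro h X₁ X₂ _ _ _ _ _ _ _ _ _ _ _ _ _ _ hcob
    obtain ⟨C, _, _, _, _, _, _, _, W, _, _, _, _, _, _, bC, bW, τ, φ, hτ, h₁, h₂⟩ := h X₁ X₂ hcob
    exact ⟨C, ‹_›, ‹_›, ‹_›, ‹_›, ‹_›, ‹_›, ‹_›, bC, W, ‹_›, ‹_›, ‹_›, ‹_›, ‹_›, ‹_›, bW, φ, τ, hτ,
      h₁, h₂⟩

/-- **The involutive form refines Matveyev's printed two-piece form** (parts 1–2 minus the `H₂`
clause, `Matveyev1996_decomposition`, at `Type`): take `W₁ = W₂ = C`, `M = W`, `φ₁ = φ`,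
`φ₂ = φ ∘ τ` and `W₁ ≅ W₂` the identity. [cite: Matveyev1996, Theorem (Introduction), parts 1–2] -/
theorem matveyev1996_decomposition_of_involutiveCorkDecomposition
    (h : involutiveCorkDecomposition) : Matveyev1996_decomposition.{0} := by
  intro X₁ X₂ _ _ _ _ _ _ _ _ _ _ _ _ _ _ hcob
  obtain ⟨C, _, _, _, _, _, hc, hk, bC, W, _, _, _, _, _, hcW, bW, φ, τ, -, h₁, h₂⟩ :=
    h X₁ X₂ hcob
  exact ⟨C, C, W, ‹_›, ‹_›, ‹_›, ‹_›, ‹_›, ‹_›, ‹_›, ‹_›, ‹_›, ‹_›, ‹_›, ‹_›, ‹_›, ‹_›, ‹_›, bC, bC,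
    bW, φ, τ.trans φ, hc, hk, hc, hk, hcW, h₁, h₂, ⟨Diffeomorph.refl _ _ _⟩⟩

/-- **The involutive form refines the one-piece cork theorem** `corkDecomposition` (at `Type`).
[cite: Matveyev1996, Theorem] [cite: KirbyCorks1996, Theorem and Addendum (D)] -/
theorem corkDecomposition_of_involutiveCorkDecomposition (h : involutiveCorkDecomposition) :
    corkDecomposition.{0} :=
  corkDecomposition_of_matveyev1996 (matveyev1996_decomposition_of_involutiveCorkDecomposition h)

/-! ### §2 The involutive cork theorem from Matveyev's part 1 with Fact 1 -/

/-- **The cork decomposition theorem WITH INVOLUTION from Matveyev's Theorem part 1 together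
with Fact 1** (`Matveyev1996_partOne_and_fact`: `X₁ = W₁ ∪_{φ₁} M`, `X₂ = W₂ ∪_{φ₂} M`,
`W₁ ∪_{id} W₁ ≅ S⁴ ≅ W₁ ∪_{ψ} W₂`, `ψ = φ₂⁻¹ ∘ φ₁`). Proof (Matveyev's proof of part 2, p. 3 and
fig. 2, with the involution it produces made explicit; Kirby 1996, §5): choose a small disc
`f : ℝ³ ↪ ∂W₁` and half-discs `k₁ ⊂ W₁`, `k_M ⊂ M`, `k₂ ⊂ W₂` with faces `f`, `φ₁ ∘ f`, `ψ ∘ f`;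
let `W' = W₁ ♮ W₂` (compact, contractible) and `M' = M ♮ W₁` (compact). By Matveyev's fig. 2
(`SeamSide.isBoundaryGluing_glued`, seam adaptation `exists_seamAdaptedWitnesses_holds`) and
`X # S⁴ ≅ X`: `X₁ = W' ∪_{id} M'` for the presentations `β₁ = incl_{W₁} # incl_{W₂}` of `∂W'` and
`β₁' = (incl_M ∘ φ₁) # (incl_{W₁} ∘ ψ⁻¹)` of `∂M'` by `Σ₁ = ∂W₁ # ∂W₂`, and — reading `W'` as
`W₂ ♮ W₁` (the same witness with the two punctured pieces exchanged, Juhász's relation being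
symmetric: `boundaryConnectedSumRel_swap`) — `X₂ = W' ∪_{id} M'` for the presentations
`β₂ = incl_{W₂} # incl_{W₁}`, `β₂' = (incl_M ∘ φ₂) # incl_{W₁}` by `Σ₂ = ∂W₂ # ∂W₁`. Re-indexing
the second gluing to `β₁, β₁'` (`BoundaryData.restrictDiffeomorph` of the identities of `W'`,
`M'`; `IsBoundaryGluing.transfer`) gives `X₂ = W' ∪_τ M'` with `τ = r'⁻¹ ∘ r`, where
`r : Σ₁ ≅ Σ₂` is `inl z ↦ inr z`, `inr w ↦ inl w` and `r' : Σ₁ ≅ Σ₂` is `inl z ↦ inl (ψ z)`,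
`inr w ↦ inr (ψ⁻¹ w)`; hence `τ (inl z) = inr (ψ z)`, `τ (inr w) = inl (ψ⁻¹ w)` and `τ ∘ τ = id`.
[cite: Matveyev1996, Theorem, Fact 1 and proof of part 2 with fig. 2 (arXiv p. 3)]
[cite: KirbyCorks1996, Theorem and Addendum (D), p. 1; §5] -/
theorem involutiveCorkDecomposition_of_partOne_and_fact (hB : Matveyev1996_partOne_and_fact.{0}) :
    involutiveCorkDecomposition := by
  have hU := nonempty_diffeomorph_of_isConnectedSum_sphere_holds.{0}
  have hE := exists_isOpenGluing_boundaryConnectedSumRel_holds.{0}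
  have hc := compactSpace_of_isOpenGluing_boundaryConnectedSumRel_holds.{0}
  have hk := contractibleSpace_of_isOpenGluing_boundaryConnectedSumRel_holds.{0}
  have hA : exists_seamAdaptedWitnesses.{0, 0} := exists_seamAdaptedWitnesses_holds
  intro X₁ X₂ _ _ _ _ _ _ _ _ _ _ _ _ _ _ hcob
  obtain ⟨W₁, W₂, M, _, _, _, _, _, _, _, _, _, _, _, _, _, _, _, b₁, b₂, bM, φ₁, φ₂, hc₁, hk₁, hc₂,
    hk₂, hcM, hX₁, hX₂, hSa, hSb⟩ := hB X₁ X₂ hcob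
  haveI : CompactSpace W₁ := hc₁
  haveI : CompactSpace W₂ := hc₂
  haveI : CompactSpace M := hcM
  haveI : ContractibleSpace W₁ := hk₁
  haveI : ContractibleSpace W₂ := hk₂
  haveI : T2Space b₁.carrier := b₁.isSmoothEmbedding.isEmbedding.t2Space
  haveI : T2Space b₂.carrier := b₂.isSmoothEmbedding.isEmbedding.t2Space
  -- the standard `S⁴` of Fact 1
  let S4 : Type := Metric.sphere (0 : EuclideanSpace ℝ (Fin (4 + 1))) 1
  -- `∂W₁ ≠ ∅` since the double of `W₁` is the connected `S⁴`
  have hne : Nonempty b₁.carrier := BoundaryData.nonempty_carrier_of_isDouble_sphere hSa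
  obtain ⟨z₀⟩ := hne
  set ψ : b₁.carrier ≃ₘ⟮𝓡 3, 𝓡 3⟯ b₂.carrier := φ₁.trans φ₂.symm with hψ
  -- boundary charts of `W₁`, `M`, `W₂` at `z₀`, `φ₁ z₀`, `ψ z₀`
  set p₁ : W₁ := b₁.incl z₀ with hp₁
  set pM : M := bM.incl (φ₁ z₀) with hpM
  set p₂ : W₂ := b₂.incl (ψ z₀) with hp₂
  set O : Set b₁.carrier := b₁.incl ⁻¹' (chartAt (EuclideanHalfSpace 4) p₁).source ∩
    (φ₁ ⁻¹' (bM.incl ⁻¹' (chartAt (EuclideanHalfSpace 4) pM).source)) ∩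
    (ψ ⁻¹' (b₂.incl ⁻¹' (chartAt (EuclideanHalfSpace 4) p₂).source)) with hO
  have hOn : O ∈ 𝓝 z₀ := by
    refine ((IsOpen.inter (IsOpen.inter ?_ ?_) ?_).mem_nhds ⟨⟨?_, ?_⟩, ?_⟩)
    · exact (chartAt _ p₁).open_source.preimage b₁.continuous_incl
    · exact ((chartAt _ pM).open_source.preimage bM.continuous_incl).preimage φ₁.continuous
    · exact ((chartAt _ p₂).open_source.preimage b₂.continuous_incl).preimage ψ.continuous
    · exact mem_chart_source _ p₁
    · exact mem_chart_source _ pM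
    · exact mem_chart_source _ p₂
  -- a small disc `f : ℝ³ ↪ ∂W₁` through `z₀` inside the three chart domains
  obtain ⟨f, hf, hfo, hfO, -⟩ := b₁.exists_disc_subset z₀ hOn
  have hfφ : Manifold.IsSmoothEmbedding (𝓡 3) (𝓡 3) ∞ (φ₁ ∘ f) := hf.diffeomorph_comp φ₁
  have hfφo : IsOpen (range (φ₁ ∘ f)) := by
    rw [range_comp]; exact φ₁.toHomeomorph.isOpenMap _ hfo
  have hfψ : Manifold.IsSmoothEmbedding (𝓡 3) (𝓡 3) ∞ (ψ ∘ f) := hf.diffeomorph_comp ψ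
  have hfψo : IsOpen (range (ψ ∘ f)) := by
    rw [range_comp]; exact ψ.toHomeomorph.isOpenMap _ hfo
  -- half-discs `k₁ ⊂ W₁`, `k_M ⊂ M`, `k₂ ⊂ W₂` with faces `f`, `φ₁ ∘ f`, `ψ ∘ f`
  obtain ⟨k₁, e₁, o₁, hface₁⟩ := exists_halfDisc_face_eq_of_subset_chartAt b₁ hf hfo p₁
    fun x' => (hfO (mem_range_self x')).1.1
  obtain ⟨kM, eM, oM, hfaceM⟩ := exists_halfDisc_face_eq_of_subset_chartAt bM hfφ hfφo pM
    fun x' => (hfO (mem_range_self x')).1.2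
  obtain ⟨k₂, e₂, o₂, hface₂⟩ := exists_halfDisc_face_eq_of_subset_chartAt b₂ hfψ hfψo p₂
    fun x' => (hfO (mem_range_self x')).2
  -- the new cork `W' = W₁ ♮ W₂` and the new exterior `M' = M ♮ W₁`
  obtain ⟨W', _, _, _, _, _, hW'⟩ := hE _ W₁ W₂ k₁ k₂ e₁ o₁ e₂ o₂
  obtain ⟨M', _, _, _, _, _, hM'⟩ := hE _ M W₁ kM k₁ eM oM e₁ o₁
  haveI : CompactSpace W' := hc _ W₁ W₂ W' k₁ k₂ e₁ o₁ e₂ o₂ hW'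
  haveI : CompactSpace M' := hc _ M W₁ M' kM k₁ eM oM e₁ o₁ hM'
  have hkW' : ContractibleSpace W' := hk _ W₁ W₂ W' k₁ k₂ hk₁ hk₂ e₁ o₁ e₂ o₂ hW'
  -- the four gluings and the correspondence of the faces of the half-discs
  have hSb' : IsBoundaryGluing b₂ b₁ ψ.symm (𝓡 4) S4 := hSb.symm'
  have hSa' : IsBoundaryGluing b₁ b₁ (Diffeomorph.refl (𝓡 3) b₁.carrier ∞) (𝓡 4) S4 :=
    isBoundaryGluing_congr (fun z => by simp) hSa.isBoundaryGluing
  have hfaceD₁ : ∀ x', k₁ (EuclideanHalfSpace.face x') = b₁.incl (ψ.symm ((ψ ∘ f) x')) :=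
    fun x' => by rw [hface₁]; simp
  have hfaceM₂ : ∀ x', kM (EuclideanHalfSpace.face x') = bM.incl (φ₂ ((ψ ∘ f) x')) :=
    fun x' => by rw [hfaceM]; simp [hψ]
  have hfaceD₂ : ∀ x', k₁ (EuclideanHalfSpace.face x') =
      b₁.incl ((Diffeomorph.refl (𝓡 3) b₁.carrier ∞) (f x')) :=
    fun x' => by rw [hface₁]; simp
  -- seam-adapted witnesses (compatibility of collars) for the four gluings
  obtain ⟨jA₁, jB₁, i₁, hjA₁, hjB₁, hcov₁, hrel₁, hi₁, hi₁o, hiu₁, hil₁⟩ :=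
    hA 2 W₁ M X₁ b₁ bM φ₁ k₁ kM f hX₁ e₁ o₁ eM oM hface₁ hfaceM
  obtain ⟨jA₂, jB₂, i₂, hjA₂, hjB₂, hcov₂, hrel₂, hi₂, hi₂o, hiu₂, hil₂⟩ :=
    hA 2 W₂ W₁ S4 b₂ b₁ ψ.symm k₂ k₁ (ψ ∘ f) hSb' e₂ o₂ e₁ o₁ hface₂ hfaceD₁
  obtain ⟨jA₃, jB₃, i₃, hjA₃, hjB₃, hcov₃, hrel₃, hi₃, hi₃o, hiu₃, hil₃⟩ :=
    hA 2 W₂ M X₂ b₂ bM φ₂ k₂ kM (ψ ∘ f) hX₂ e₂ o₂ eM oM hface₂ hfaceM₂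
  obtain ⟨jA₄, jB₄, i₄, hjA₄, hjB₄, hcov₄, hrel₄, hi₄, hi₄o, hiu₄, hil₄⟩ :=
    hA 2 W₁ W₁ S4 b₁ b₁ (Diffeomorph.refl (𝓡 3) b₁.carrier ∞) k₁ k₁ f hSa' e₁ o₁ e₁ o₁ hface₁
      hfaceD₂
  -- the four sides: `X₁ = W₁ ∪ M`, `S⁴ = W₂ ∪ W₁`, `X₂ = W₂ ∪ M`, `S⁴ = W₁ ∪ W₁`
  let G₁ : SeamSide 2 W₁ M X₁ :=
    ⟨b₁, bM, φ₁, k₁, kM, f, jA₁, jB₁, i₁, e₁, o₁, eM, oM, hface₁, hfaceM, hjA₁, hjB₁, hcov₁, hrel₁,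
      hi₁, hi₁o, hiu₁, hil₁⟩
  let G₂ : SeamSide 2 W₂ W₁ S4 :=
    ⟨b₂, b₁, ψ.symm, k₂, k₁, ψ ∘ f, jA₂, jB₂, i₂, e₂, o₂, e₁, o₁, hface₂, hfaceD₁, hjA₂, hjB₂,
      hcov₂, hrel₂, hi₂, hi₂o, hiu₂, hil₂⟩
  let G₁' : SeamSide 2 W₂ M X₂ :=
    ⟨b₂, bM, φ₂, k₂, kM, ψ ∘ f, jA₃, jB₃, i₃, e₂, o₂, eM, oM, hface₂, hfaceM₂, hjA₃, hjB₃, hcov₃,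
      hrel₃, hi₃, hi₃o, hiu₃, hil₃⟩
  let G₂' : SeamSide 2 W₁ W₁ S4 :=
    ⟨b₁, b₁, Diffeomorph.refl (𝓡 3) b₁.carrier ∞, k₁, k₁, f, jA₄, jB₄, i₄, e₁, o₁, e₁, o₁, hface₁,
      hfaceD₂, hjA₄, hjB₄, hcov₄, hrel₄, hi₄, hi₄o, hiu₄, hil₄⟩
  -- ONE witness `Wh` of `W' = W₁ ♮ W₂`, read also as a witness `Whs` of `W' = W₂ ♮ W₁` (Kirby's
  -- "obvious involution": the same manifold seen from either side), and one of `M' = M ♮ W₁`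
  let Wh : HalfGluing G₁.kA G₂.kA W' := Classical.choice (HalfGluing.nonempty_of_isOpenGluing hW')
  let Whs : HalfGluing G₁'.kA G₂'.kA W' :=
    ⟨Wh.ι₂, Wh.ι₁, Wh.h₂, Wh.h₂o, Wh.h₁, Wh.h₁o, (union_comm _ _).trans Wh.cover, fun c a => by
      rw [eq_comm, Wh.rel a c, ← boundaryConnectedSumRel_swap]⟩
  let Wh' : HalfGluing G₁.kB G₂.kB M' :=
    Classical.choice (HalfGluing.nonempty_of_isOpenGluing hM')
  -- chain 1: `X₁ ≅ X₁ # S⁴ = (W₁ ∪_{φ₁} M) # (W₂ ∪_{ψ⁻¹} W₁) = W' ∪_{id} M'` on `β₁, β₁'`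
  obtain ⟨eQ₁⟩ := hU _ X₁ _ ((SeamSide.pairData G₁ G₂).isConnectedSum_glued SeamSide.two_ne)
  have hg₁X : IsBoundaryGluing (SeamSide.βAC G₁ G₂ Wh) (SeamSide.βBD G₁ G₂ Wh')
      (Diffeomorph.refl (𝓡 3) _ ∞) (𝓡 4) X₁ :=
    (SeamSide.isBoundaryGluing_glued G₁ G₂ Wh Wh').diffeomorph_comp eQ₁
  -- chain 2: `X₂ ≅ X₂ # S⁴ = (W₂ ∪_{φ₂} M) # (W₁ ∪_{id} W₁) = W' ∪_{id} M'` on `β₂, β₂'`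
  obtain ⟨eQ₂⟩ := hU _ X₂ _ ((SeamSide.pairData G₁' G₂').isConnectedSum_glued SeamSide.two_ne)
  have hg₂X : IsBoundaryGluing (SeamSide.βAC G₁' G₂' Whs) (SeamSide.βBD G₁' G₂' Wh')
      (Diffeomorph.refl (𝓡 3) _ ∞) (𝓡 4) X₂ :=
    (SeamSide.isBoundaryGluing_glued G₁' G₂' Whs Wh').diffeomorph_comp eQ₂
  -- the boundary data and the re-indexing diffeomorphisms `r = ∂(id_{W'})`, `r' = ∂(id_{M'})`
  set β₁ := SeamSide.βAC G₁ G₂ Wh with hβ₁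
  set β₁' := SeamSide.βBD G₁ G₂ Wh' with hβ₁'
  set β₂ := SeamSide.βAC G₁' G₂' Whs with hβ₂
  set β₂' := SeamSide.βBD G₁' G₂' Wh' with hβ₂'
  set r : β₁.carrier ≃ₘ⟮𝓡 3, 𝓡 3⟯ β₂.carrier :=
    β₁.restrictDiffeomorph β₂ (Diffeomorph.refl (𝓡∂ 4) W' ∞) with hr
  set r' : β₁'.carrier ≃ₘ⟮𝓡 3, 𝓡 3⟯ β₂'.carrier :=
    β₁'.restrictDiffeomorph β₂' (Diffeomorph.refl (𝓡∂ 4) M' ∞) with hr'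
  -- `X₂ = W' ∪_{r'⁻¹ ∘ r} M'` on `β₁, β₁'`
  have h₁ : IsBoundaryGluing β₁ β₂' (r.trans (Diffeomorph.refl (𝓡 3) _ ∞)) (𝓡 4) X₂ :=
    IsClosedGluing.congr (hg₂X.transfer (b₁ := β₁) (Diffeomorph.refl (𝓡∂ 4) W' ∞))
      fun a b => Iff.rfl
  have h₂ : IsBoundaryGluing β₁' β₁
      (r'.trans (r.trans (Diffeomorph.refl (𝓡 3) _ ∞)).symm) (𝓡 4) X₂ :=
    IsClosedGluing.congr (h₁.symm'.transfer (b₁ := β₁') (Diffeomorph.refl (𝓡∂ 4) M' ∞))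
      fun a b => Iff.rfl
  -- the twist `τ = r'⁻¹ ∘ r`, a self-diffeomorphism of `Σ₁ = ∂W₁ # ∂W₂`
  let τ : β₁.carrier ≃ₘ⟮𝓡 3, 𝓡 3⟯ β₁.carrier := r.trans r'.symm
  have hX₂' : IsBoundaryGluing β₁ β₁' (τ.trans (Diffeomorph.refl (𝓡 3) _ ∞)) (𝓡 4) X₂ :=
    isBoundaryGluing_congr (fun z => rfl) h₂.symm'
  /- The boundary carriers: `Σ₁ = ∂W₁ # ∂W₂` along the discs `f`, `ψ ∘ f` (carrier of `β₁`,
  `β₁'`) and `Σ₂ = ∂W₂ # ∂W₁` along `ψ ∘ f`, `f` (carrier of `β₂`, `β₂'`). -/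
  have hD₁ : (SeamSide.sigmaData G₁ G₂).i₁ = f := SeamSide.sigmaData_i₁ G₁ G₂
  have hD₂ : (SeamSide.sigmaData G₁ G₂).i₂ = ψ ∘ f := SeamSide.sigmaData_i₂ G₁ G₂
  have hD₁' : (SeamSide.sigmaData G₁' G₂').i₁ = ψ ∘ f := SeamSide.sigmaData_i₁ G₁' G₂'
  have hD₂' : (SeamSide.sigmaData G₁' G₂').i₂ = f := SeamSide.sigmaData_i₂ G₁' G₂'
  have mA₁ : ∀ {z : b₁.carrier}, z ≠ f 0 → z ∈ (SeamSide.sigmaData G₁ G₂).A := fun {z} hz => by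
    show z ≠ _
    rw [hD₁]; exact hz
  have mB₁ : ∀ {w : b₂.carrier}, w ≠ ψ (f 0) → w ∈ (SeamSide.sigmaData G₁ G₂).B := fun {w} hw => by
    show w ≠ _
    rw [hD₂]; exact hw
  have mA₂ : ∀ {w : b₂.carrier}, w ≠ ψ (f 0) → w ∈ (SeamSide.sigmaData G₁' G₂').A :=
    fun {w} hw => by
    show w ≠ _
    rw [hD₁']; exact hw
  have mB₂ : ∀ {z : b₁.carrier}, z ≠ f 0 → z ∈ (SeamSide.sigmaData G₁' G₂').B := fun {z} hz => by
    show z ≠ _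
    rw [hD₂']; exact hz
  have nA₁ : ∀ {z : b₁.carrier}, z ∈ (SeamSide.sigmaData G₁ G₂).A → z ≠ f 0 := fun {z} hz => by
    have h : z ≠ _ := (mem_puncture).1 hz
    rwa [hD₁] at h
  have nB₁ : ∀ {w : b₂.carrier}, w ∈ (SeamSide.sigmaData G₁ G₂).B → w ≠ ψ (f 0) :=
    fun {w} hw => by
    have h : w ≠ _ := (mem_puncture).1 hw
    rwa [hD₂] at h
  have hψne : ∀ {z : b₁.carrier}, z ≠ f 0 → ψ z ≠ ψ (f 0) := fun hz h => hz (ψ.injective h)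
  have hψne' : ∀ {w : b₂.carrier}, w ≠ ψ (f 0) → ψ.symm w ≠ f 0 := fun {w} hw h =>
    hw (by rw [← h, Diffeomorph.apply_symm_apply])
  -- `r : inl z ↦ inr z`, `inr w ↦ inl w` (the same points of `W'`)
  have r_inl : ∀ (z : b₁.carrier) (hz : z ∈ (SeamSide.sigmaData G₁ G₂).A)
      (hz' : z ∈ (SeamSide.sigmaData G₁' G₂').B),
      r ((SeamSide.sigmaGlue G₁ G₂).inl ⟨z, hz⟩) = (SeamSide.sigmaGlue G₁' G₂').inr ⟨z, hz'⟩ := by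
    intro z hz hz'
    apply β₂.injective_incl
    rw [hr, BoundaryData.incl_restrictDiffeomorph]
    rfl
  have r_inr : ∀ (w : b₂.carrier) (hw : w ∈ (SeamSide.sigmaData G₁ G₂).B)
      (hw' : w ∈ (SeamSide.sigmaData G₁' G₂').A),
      r ((SeamSide.sigmaGlue G₁ G₂).inr ⟨w, hw⟩) = (SeamSide.sigmaGlue G₁' G₂').inl ⟨w, hw'⟩ := by
    intro w hw hw'
    apply β₂.injective_incl
    rw [hr, BoundaryData.incl_restrictDiffeomorph]
    rfl
  -- `r' : inl z ↦ inl (ψ z)`, `inr w ↦ inr (ψ⁻¹ w)` (the same points of `M'`)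
  have r'_inl : ∀ (z : b₁.carrier) (hz : z ∈ (SeamSide.sigmaData G₁ G₂).A)
      (hz' : ψ z ∈ (SeamSide.sigmaData G₁' G₂').A),
      r' ((SeamSide.sigmaGlue G₁ G₂).inl ⟨z, hz⟩) =
        (SeamSide.sigmaGlue G₁' G₂').inl ⟨ψ z, hz'⟩ := by
    intro z hz hz'
    apply β₂'.injective_incl
    rw [hr', BoundaryData.incl_restrictDiffeomorph]
    show Wh'.ι₁ ⟨bM.incl (φ₁ z), _⟩ = Wh'.ι₁ ⟨bM.incl (φ₂ (ψ z)), _⟩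
    congr 1
    apply Subtype.ext
    show bM.incl (φ₁ z) = bM.incl (φ₂ (ψ z))
    simp [hψ]
  have r'_inr : ∀ (w : b₂.carrier) (hw : w ∈ (SeamSide.sigmaData G₁ G₂).B)
      (hw' : ψ.symm w ∈ (SeamSide.sigmaData G₁' G₂').B),
      r' ((SeamSide.sigmaGlue G₁ G₂).inr ⟨w, hw⟩) =
        (SeamSide.sigmaGlue G₁' G₂').inr ⟨ψ.symm w, hw'⟩ := by
    intro w hw hw'
    apply β₂'.injective_incl
    rw [hr', BoundaryData.incl_restrictDiffeomorph]
    rfl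
  -- `τ = r'⁻¹ ∘ r : inl z ↦ inr (ψ z)`, `inr w ↦ inl (ψ⁻¹ w)`
  have τ_inl : ∀ (z : b₁.carrier) (hz : z ∈ (SeamSide.sigmaData G₁ G₂).A)
      (hz' : ψ z ∈ (SeamSide.sigmaData G₁ G₂).B),
      τ ((SeamSide.sigmaGlue G₁ G₂).inl ⟨z, hz⟩) = (SeamSide.sigmaGlue G₁ G₂).inr ⟨ψ z, hz'⟩ := by
    intro z hz hz'
    -- `r' (inr (ψ z)) = inr (ψ⁻¹ (ψ z)) = inr z = r (inl z)` in `Σ₂`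
    have e : (⟨ψ.symm (ψ z), mB₂ (hψne' (nB₁ hz'))⟩ : (SeamSide.sigmaData G₁' G₂').B) =
        ⟨z, mB₂ (nA₁ hz)⟩ := Subtype.ext (ψ.symm_apply_apply z)
    have h3 : r' ((SeamSide.sigmaGlue G₁ G₂).inr ⟨ψ z, hz'⟩) =
        r ((SeamSide.sigmaGlue G₁ G₂).inl ⟨z, hz⟩) :=
      ((r'_inr (ψ z) hz' (mB₂ (hψne' (nB₁ hz')))).trans
        (congrArg (SeamSide.sigmaGlue G₁' G₂').inr e)).trans (r_inl z hz (mB₂ (nA₁ hz))).symm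
    -- `τ (inl z) = r'⁻¹ (r (inl z)) = r'⁻¹ (r' (inr (ψ z))) = inr (ψ z)`
    exact (congrArg r'.symm h3).symm.trans (r'.symm_apply_apply _)
  have τ_inr : ∀ (w : b₂.carrier) (hw : w ∈ (SeamSide.sigmaData G₁ G₂).B)
      (hw' : ψ.symm w ∈ (SeamSide.sigmaData G₁ G₂).A),
      τ ((SeamSide.sigmaGlue G₁ G₂).inr ⟨w, hw⟩) =
        (SeamSide.sigmaGlue G₁ G₂).inl ⟨ψ.symm w, hw'⟩ := by
    intro w hw hw'
    -- `r' (inl (ψ⁻¹ w)) = inl (ψ (ψ⁻¹ w)) = inl w = r (inr w)` in `Σ₂`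
    have e : (⟨ψ (ψ.symm w), mA₂ (hψne (nA₁ hw'))⟩ : (SeamSide.sigmaData G₁' G₂').A) =
        ⟨w, mA₂ (nB₁ hw)⟩ := Subtype.ext (ψ.apply_symm_apply w)
    have h3 : r' ((SeamSide.sigmaGlue G₁ G₂).inl ⟨ψ.symm w, hw'⟩) =
        r ((SeamSide.sigmaGlue G₁ G₂).inr ⟨w, hw⟩) :=
      ((r'_inl (ψ.symm w) hw' (mA₂ (hψne (nA₁ hw')))).trans
        (congrArg (SeamSide.sigmaGlue G₁' G₂').inl e)).trans (r_inr w hw (mA₂ (nB₁ hw))).symm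
    -- `τ (inr w) = r'⁻¹ (r (inr w)) = r'⁻¹ (r' (inl (ψ⁻¹ w))) = inl (ψ⁻¹ w)`
    exact (congrArg r'.symm h3).symm.trans (r'.symm_apply_apply _)
  -- `τ` is an involution
  have hτ : Involutive τ := by
    intro x
    rcases (SeamSide.sigmaGlue G₁ G₂).exists_inl_or_inr x with ⟨⟨z, hz⟩, rfl⟩ | ⟨⟨w, hw⟩, rfl⟩
    · have hz₁ : ψ z ∈ (SeamSide.sigmaData G₁ G₂).B := mB₁ (hψne (nA₁ hz))
      have hz₂ : ψ.symm (ψ z) ∈ (SeamSide.sigmaData G₁ G₂).A := mA₁ (hψne' (hψne (nA₁ hz)))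
      have e : (⟨ψ.symm (ψ z), hz₂⟩ : (SeamSide.sigmaData G₁ G₂).A) = ⟨z, hz⟩ :=
        Subtype.ext (ψ.symm_apply_apply z)
      exact (congrArg τ (τ_inl z hz hz₁)).trans
        ((τ_inr (ψ z) hz₁ hz₂).trans (congrArg (SeamSide.sigmaGlue G₁ G₂).inl e))
    · have hw₁ : ψ.symm w ∈ (SeamSide.sigmaData G₁ G₂).A := mA₁ (hψne' (nB₁ hw))
      have hw₂ : ψ (ψ.symm w) ∈ (SeamSide.sigmaData G₁ G₂).B := mB₁ (hψne (hψne' (nB₁ hw)))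
      have e : (⟨ψ (ψ.symm w), hw₂⟩ : (SeamSide.sigmaData G₁ G₂).B) = ⟨w, hw⟩ :=
        Subtype.ext (ψ.apply_symm_apply w)
      exact (congrArg τ (τ_inr w hw hw₁)).trans
        ((τ_inl (ψ.symm w) hw₁ hw₂).trans (congrArg (SeamSide.sigmaGlue G₁ G₂).inr e))
  exact ⟨W', ‹_›, ‹_›, ‹_›, ‹_›, ‹_›, ‹_›, hkW', β₁, M', ‹_›, ‹_›, ‹_›, ‹_›, ‹_›, ‹_›, β₁',
    Diffeomorph.refl (𝓡 3) _ ∞, τ, hτ, hg₁X, hX₂'⟩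

/-- **The rendering `matveyev1996_involutiveDecomposition` from Matveyev's part 1 with Fact 1**
(through `involutiveCorkDecomposition_iff_matveyev1996_involutiveDecomposition`).
[cite: Matveyev1996, Theorem, Fact 1 and proof of part 2 with fig. 2 (arXiv p. 3)]
[cite: KirbyCorks1996, Theorem and Addendum (D), p. 1] -/
theorem matveyev1996_involutiveDecomposition_of_partOne_and_fact
    (hB : Matveyev1996_partOne_and_fact.{0}) : matveyev1996_involutiveDecomposition :=
  involutiveCorkDecomposition_iff_matveyev1996_involutiveDecomposition.1
    (involutiveCorkDecomposition_of_partOne_and_fact hB)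

/-! ### §3 From the current leaves of the cork DAG -/

/-- **The involutive cork theorem from the two remaining leaves (B) and (H4)** of the tree's
cork DAG — the middle level of the two-three handlebody
(`exists_dualSpheres_middleLevel_of_two_three`) and the four-dimensional construction from the
middle level on with Fact 1 (`Matveyev1996_partOne_and_fact_of_dualSpheres`) —, by
`matveyev1996_partOne_and_fact_of_middleLevel_leaves` (`CorkDecompositionProofs.lean`).
[cite: Matveyev1996, Theorem 1 and its proof (arXiv pp. 1–3)]
[cite: KirbyCorks1996, Theorem and Addenda (B)–(D)] -/
theorem involutiveCorkDecomposition_of_middleLevel_leaves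
    (hB : exists_dualSpheres_middleLevel_of_two_three.{0})
    (h4 : Matveyev1996_partOne_and_fact_of_dualSpheres.{0}) : involutiveCorkDecomposition :=
  involutiveCorkDecomposition_of_partOne_and_fact
    (matveyev1996_partOne_and_fact_of_middleLevel_leaves hB h4)

/-- **The involutive cork theorem from the two children of the split record**
`CorkDecompositionSplit.lean`: Milnor's Basis Theorem 7.6 on a slab
(`Cobordism.Milnor1965_basisTheorem_slab`, giving (B) by
`exists_dualSpheres_middleLevel_of_two_three_of_basisTheorem`) and (H4)
(`Matveyev1996_partOne_and_fact_of_dualSpheres`). When both are discharged,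
`involutiveCorkDecomposition_holds` is this theorem applied to their `_holds`, exactly as for
`corkDecomposition_holds_of`. [cite: Matveyev1996, Theorem 1 and its proof (arXiv pp. 1–3)]
[cite: KirbyCorks1996, Theorem and Addendum (D)] [cite: MilnorHCobordism1965, Thm. 7.6 (PDF p. 50), Thm. 8.1] -/
theorem involutiveCorkDecomposition_holds_of (h76 : Cobordism.Milnor1965_basisTheorem_slab.{0})
    (h4 : Matveyev1996_partOne_and_fact_of_dualSpheres.{0}) : involutiveCorkDecomposition :=
  involutiveCorkDecomposition_of_middleLevel_leaves
    (exists_dualSpheres_middleLevel_of_two_three_of_basisTheorem h76) h4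

/-- **The involutive cork theorem from (H4) alone.**  Milnor's Basis Theorem 7.6 on a slab is
now discharged (`Cobordism.Milnor1965_basisTheorem_slab_holds`, `HCobordismSlideStepSign.lean`),
hence so is rung (B), the middle level of the two-three handlebody
(`exists_dualSpheres_middleLevel_of_two_three_holds`, `CorkDecompositionMiddleLevelOfBasisTheorem.lean`);
the single remaining leaf below `Literature.Topology.FourManifolds.involutiveCorkDecomposition`
is (H4) `Literature.Topology.FourManifolds.Matveyev1996_partOne_and_fact_of_dualSpheres` — the
four-dimensional construction from the middle level on (Kirby 1996 §3 and §4, Addenda (B), (C);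
Matveyev 1996 pp. 1–3 with Fact 1; the algebra of Kirby's §4 is in
`TriangularPresentationAndrewsCurtis.lean`).  Once it is discharged,
`theorem involutiveCorkDecomposition_holds : involutiveCorkDecomposition :=
involutiveCorkDecomposition_of_dualSpheres Matveyev1996_partOne_and_fact_of_dualSpheres_holds`
is to be appended here (cf. `matveyev1996_involutiveDecomposition_of_dualSpheres` of
`CorkDecompositionInvolutiveProofs.lean` for the twin statement).
[cite: KirbyCorks1996, Theorem and Addendum (D), §§2–5 (arXiv:math/9712231)]
[cite: MilnorHCobordism1965, Thm. 7.6 (PDF pp. 50–52), Thm. 8.1] -/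
theorem involutiveCorkDecomposition_of_dualSpheres
    (h4 : Matveyev1996_partOne_and_fact_of_dualSpheres.{0}) : involutiveCorkDecomposition :=
  involutiveCorkDecomposition_of_middleLevel_leaves
    exists_dualSpheres_middleLevel_of_two_three_holds h4

end Literature.Topology.FourManifolds

end
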